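import Literature.NumberTheory.GaloisCohomology.BrauerSumInvCyclicClassPositive
import Literature.NumberTheory.GaloisCohomology.PoitouTateNumberField
import Literature.NumberTheory.GaloisCohomology.ArchimedeanCyclicClassEvaluation
import HarnessLib

/-!
# The local invariant of a global cyclic class is the local Artin symbol, I: Tate's device
# (Serre, *Corps locaux* XIV §1 Prop. 3 `(χ, b)_v = χ(s_b)` — the place `v` arbitrary, side conditions elsewhere)

Let `K` be a number field, `n ≥ 1`, `ψ : Γ_K ↠ ℤ/n` a cyclic character cutting out the finite abelian
`L ⊆ K̄` (`ker ψ = Gal(K̄/L)`), `b ∈ Kˣ`, and `c = κₙ(b) ∪ ψ ∈ H²(Γ_K, μₙ)` the global cyclic class.  For a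
finite place `v` write `inv_v = localInvariantMap K n v` (THE invariant map of `K_v`,
`LocalInvariantMap.lean`), `Art_v = canonicalArtin K_v : W_{K_v} ↠ K_vˣ` (THE local Artin map, Deligne's
normalisation) and `ψ_{L|K} : 𝕀_K → Gal(L/K)` for the global Artin map.

The tree evaluates `inv_v (loc_v c)` at the places where `ψ` is UNRAMIFIED
(`localInvariantMap_localization_cupProduct_δ₀`: `ψ(Frob_v) · ord_v(b)`, Serre XIV §1 Prop. 3 with XIII §4
Prop. 13).  This file and its sequel `CyclicClassLocalArtinSymbol.lean` prove Serre's `(χ, b)_v = χ(s_b)`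
at EVERY finite place for `χ = ψ ∘ res_v`:

  `inv_v (loc_v (κₙ(b) ∪ ψ)) = -ψ(res_v w)`   for any `w ∈ W_{K_v}` with `Art_v w = b`,

i.e. the character `ψ̄` of `Gal(L/K)` evaluated on the local Artin symbol `ψ_{L|K}(⟨b⟩_v) = ((res_v w)|_L)⁻¹`
(`artinIdeleMap_localUnits_canonicalArtin_eq_inv`; the sign is Deligne's normalisation).  Here: the step
with SIDE CONDITIONS at the other places (Tate's device, Cassels–Fröhlich VII §10–§11 — the global
reciprocity law computes the local symbols):

* §0 lemmas: the character `ψ̄` of `Gal(L/K)` (`exists_character_absRestrictNormalHom_eq`); off a norm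
  modulus `S₀` of `L/K` (`exists_map_unitIdelesOutside_le`) the Artin map kills the local units
  (`artinIdeleMap_localUnits_eq_one_of_not_mem`) and `ψ` kills the inertia groups
  (`apply_absGaloisRestrict_eq_zero_of_mem_absInertia_of_not_mem`);
* §1 **`localInvariantMap_localization_cupProduct_δ₀_eq_neg_apply_of_forall_ne`**: if `b` is positive at
  the real places and `loc_{v'}(κₙ(b) ∪ ψ) = 0` at every ramified `v' ≠ v`, then with
  `t_{v'} = ψ̄(ψ_{L|K}⟨b⟩_{v'})`: (A) `t_{v'} = inv_{v'}(loc_{v'} c)` for `v' ≠ v` (unramified evaluation,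
  resp. `loc = 0 ⇒ b` a local norm ⇒ `ψ_{L|K}⟨b⟩_{v'} = 1`, `mem_range_norm_compositum_of_resMu_cupProduct_δ₀_eq_zero`);
  (B) `∑_{v'} t_{v'} = 0` (Artin reciprocity for the principal idèle of `b`, as in
  `sum_localInvariantMap_localization_cupProduct_δ₀_eq_zero`); (C) `∑_{v'} inv_{v'}(loc_{v'} c) = 0` (the
  reciprocity law of the Brauer group for THE invariant maps of every number field,
  `sumInvLocalizationEqZero_canonical_of_numberField`; the archimedean terms vanish by positivity); hence
  `inv_v(loc_v c) = t_v = -ψ(res_v w)`.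

Proof file: theorems only (no definition, no named fact, no instance; D-0026).  HONEST FRAMING: textbook
class field theory; proves no case of Poitou–Tate duality `Ker γ¹ ⊆ Im β¹` and no case of BSD — it is the
local value identity on which the `μₙ` / `ℤ/n` cases of Milne *ADT* I Thm. 4.10(b) for THE invariant maps
rest (cell bsd-schneider-ideate, crux `AnticycControlAdditiveK`, FINDING door-c6 g5 §6 (C)).

## References

* J.-P. Serre, *Corps locaux* / *Local Fields* (1979), XIV §1 Prop. 2 Cor. 1, Prop. 3. [SerreLocalFields1979]
* J. Tate, *Global class field theory*, Ch. VII of Cassels–Fröhlich (1967), §10, §11. [CasselsFrohlichANT1967]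
* J. Neukirch, *Algebraic Number Theory* (1999), VI (5.6)–(5.8). [NeukirchANT1999]

## Tree search

`lean search 'localInvariantMap_localization_cupProduct_δ₀|invLevel_cupProduct'`: only the unramified
evaluations (`LocalInvariantMapEvaluation.lean`).  Inputs: `BrauerSumInvCyclicClass(…Positive)`,
`PoitouTateNumberField.sumInvLocalizationEqZero_canonical_of_numberField`, `ArchimedeanCyclicClassEvaluation`,
`ArtinMapLocalNormKernel`, `GlobalExistenceTheoremReductionProofs` (`unitIdelesOutside`), `WeilGroup`.
-/

noncomputable section

open CategoryTheory Function NumberField IsDedekindDomain Field ValuativeRel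
open scoped NumberField

namespace Literature.NumberTheory.GaloisCohomology

open _root_.ContinuousCohomology
open Literature.NumberTheory.GaloisRepresentations
open Literature.NumberTheory.GaloisRepresentations.DiscreteGaloisModule
open Literature.NumberTheory.GaloisRepresentations.LocalWeilDatum
open Literature.NumberTheory.GaloisRepresentations.IsNonarchimedeanLocalField
open Literature.NumberTheory.NumberFields
open Literature.AnabelianGeometry.AbsoluteAnabelian
open Literature.AnabelianGeometry.AbsoluteAnabelian.Prop121vii

variable {K : Type} [Field K] [NumberField K] {n : ℕ} [NeZero n]
  (L : IntermediateField K (AlgebraicClosure K)) [FiniteDimensional K L] [IsAbelianGalois K L]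
  [NumberField L]

/-! ### §0. Lemmas: the character `ψ̄` of `Gal(L/K)`; units outside a norm modulus; unramified places -/

section Lemmas

omit [NumberField K] [NeZero n] [FiniteDimensional K L] [NumberField L] in
/-- **The character `ψ̄` of `Gal(L/K)` induced by `ψ`**: `ψ̄ (γ|_L) = ψ γ` (`ker ψ = Gal(K̄/L)` and
`Γ_K ↠ Gal(L/K)`). [cite: NeukirchANT1999, Ch. VI §5 Prop. (5.6)] -/
theorem exists_character_absRestrictNormalHom_eq (ψ : CyclicCharacter (absoluteGaloisGroup K) n)
    (hker : ψ.ker = galFixing K L) :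
    ∃ ψbar : (L ≃ₐ[K] L) →* Multiplicative (ZMod n),
      ∀ γ : absoluteGaloisGroup K, ψbar (absRestrictNormalHom L γ) = Multiplicative.ofAdd (ψ γ) := by
  have hle : (absRestrictNormalHom L).ker ≤ ψ.toMonoidHom.ker := by
    intro γ hγ
    rw [MonoidHom.mem_ker, absRestrictNormalHom_eq_one_iff] at hγ
    have hγ' : γ ∈ ψ.ker := by rw [hker]; exact hγ
    rw [CyclicCharacter.mem_ker] at hγ'
    rw [MonoidHom.mem_ker]
    change Multiplicative.ofAdd (ψ γ) = 1
    rw [hγ', ofAdd_zero]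
  exact ⟨(absRestrictNormalHom L).liftOfSurjective (absRestrictNormalHom_surjective L) ⟨ψ.toMonoidHom, hle⟩,
    fun γ => (absRestrictNormalHom L).liftOfRightInverse_comp_apply _ _ _ γ⟩

omit [NeZero n] in
/-- **Local units outside a norm modulus are killed by the Artin map**: if `U_K^{S₀} Kˣ/Kˣ ⊆ N_{L|K}C_L`
(`exists_map_unitIdelesOutside_le`), then `ψ_{L|K}(⟨x⟩_v) = 1` for every finite `v ∉ S₀` and every
`x ∈ 𝒪_vˣ`. [cite: NeukirchANT1999, Ch. VI §5 Cor. (5.8)] -/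
theorem artinIdeleMap_localUnits_eq_one_of_not_mem {S₀ : Finset (HeightOneSpectrum (𝓞 K))}
    (hS₀ : (unitIdelesOutside K S₀).map (QuotientGroup.mk' (principalIdeles K)) ≤ normClassGroup K L)
    {v : HeightOneSpectrum (𝓞 K)} (hv : v ∉ S₀) (x : (v.adicCompletion K)ˣ)
    (hx : Valued.v (x : v.adicCompletion K) = 1) :
    artinIdeleMap L artinReciprocity_character_holds (localUnits v x) = 1 := by
  have hmemU : localUnits v x ∈ unitIdelesOutside K S₀ := by
    refine ⟨localUnits_fst v x, fun v' hv' => ?_, fun v' => ?_⟩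
    · have hne : v' ≠ v := fun h => hv (h ▸ hv')
      exact finiteAdeleSingle_apply_of_ne (x : v.adicCompletion K) hne
    · by_cases h : v' = v
      · subst h
        rw [localUnits_snd_apply_self]
        exact hx
      · change Valued.v (finiteAdeleSingle v (x : v.adicCompletion K) v') = 1
        rw [finiteAdeleSingle_apply_of_ne (x : v.adicCompletion K) h, map_one]
  have hmem : QuotientGroup.mk' (principalIdeles K) (localUnits v x) ∈ normClassGroup K L :=
    hS₀ (Subgroup.mem_map_of_mem _ hmemU)
  rw [← ker_artinClassMap_eq L, MonoidHom.mem_ker, QuotientGroup.mk'_apply, artinClassMap_mk] at hmem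
  exact hmem

omit [NeZero n] in
/-- **`ψ` is unramified outside a norm modulus**: if `U_K^{S₀} Kˣ/Kˣ ⊆ N_{L|K}C_L` and `ker ψ = Gal(K̄/L)`,
then `ψ ∘ res_v` kills the inertia group of `Γ_{K_v}` at every finite `v ∉ S₀` (an inertia element is
`w ∈ I ≤ W_{K_v}`, `Art_v w ∈ 𝒪_vˣ` is killed by `ψ_{L|K}`, and `ψ_{L|K}(⟨Art_v w⟩_v) = ((res w)|_L)⁻¹`).
[cite: NeukirchANT1999, Ch. VI §5 Prop. (5.6), §6 Cor. (6.6)] -/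
theorem apply_absGaloisRestrict_eq_zero_of_mem_absInertia_of_not_mem
    (ψ : CyclicCharacter (absoluteGaloisGroup K) n) (hker : ψ.ker = galFixing K L)
    {S₀ : Finset (HeightOneSpectrum (𝓞 K))}
    (hS₀ : (unitIdelesOutside K S₀).map (QuotientGroup.mk' (principalIdeles K)) ≤ normClassGroup K L)
    {v : HeightOneSpectrum (𝓞 K)} (hv : v ∉ S₀)
    (σ : absoluteGaloisGroup (v.adicCompletion K)) (hσ : σ ∈ absInertia (v.adicCompletion K)) :
    ψ (absGaloisRestrict K (v.adicCompletion K) σ) = 0 := by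
  set F := v.adicCompletion K with hF
  have ha := isLocalArtinMap_canonicalArtin_holds F
  -- the inertia element as an element of the Weil group
  set i : WeilGroup F := WeilGroup.mk σ ⟨0, isFrobPow_zero_iff_mem_absInertia.mpr hσ⟩ with hi_def
  have hiσ : WeilGroup.toAbsGalois F i = σ := WeilGroup.toAbsGalois_mk _ _
  have hi : i ∈ WeilGroup.inertia F := by rw [WeilGroup.mem_inertia_iff, hiσ]; exact hσ
  -- `Art_v i` is a unit
  have hunit : valuation F (canonicalArtin F i : F) = 1 := by
    have hmem : canonicalArtin F i ∈ (valuation F).valuationSubring.unitGroup := by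
      rw [← ha.image_inertia]; exact Subgroup.mem_map_of_mem _ hi
    exact (Valuation.mem_unitGroup_iff _ _ _).mp hmem
  have hle : ∀ a b : F, valuation F a ≤ valuation F b ↔ Valued.v a ≤ Valued.v b := fun a b =>
    (Valuation.vle_iff_le (valuation F)).symm.trans (Valuation.vle_iff_le Valued.v)
  have hunit' : Valued.v (canonicalArtin F i : F) = 1 := by
    refine le_antisymm ?_ ?_
    · rw [← (Valued.v : Valuation F (WithZero (Multiplicative ℤ))).map_one, ← hle, (valuation F).map_one,
        hunit]
    · rw [← (Valued.v : Valuation F (WithZero (Multiplicative ℤ))).map_one, ← hle, (valuation F).map_one,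
        hunit]
  -- hence killed by the Artin map, and `(res σ)|_L = 1`
  have h1 := artinIdeleMap_localUnits_eq_one_of_not_mem L hS₀ hv (canonicalArtin F i) hunit'
  rw [artinIdeleMap_localUnits_canonicalArtin_eq_inv L i, inv_eq_one, hiσ, absRestrictNormalHom_eq_one_iff]
    at h1
  have h2 : absGaloisRestrict K F σ ∈ ψ.ker := by rw [hker]; exact h1
  exact (CyclicCharacter.mem_ker _).mp h2

end Lemmas

/-! ### §1. Tate's device: the identity under side conditions at the other places -/

section SideConditions

/-- **`inv_v (loc_v (κₙ(b) ∪ ψ)) = -ψ(res_v w)` for `Art_v w = b`, under side conditions** (Tate,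
Cassels–Fröhlich VII §10–11; Serre XIV §1 Prop. 3 at the place `v`): `b ∈ Kˣ` positive at every real place,
and the class `κₙ(b) ∪ ψ` vanishing at every finite place `v' ≠ v` where `ψ` is ramified.  Mechanism in the
module docstring: Artin reciprocity for the principal idèle of `b` gives `∑_{v'} ψ̄(ψ_{L|K}⟨b⟩_{v'}) = 0`,
the reciprocity law of the Brauer group gives `∑_{v'} inv_{v'}(loc_{v'} c) = 0`, and the terms agree at
every `v' ≠ v`. [cite: SerreLocalFields1979, XIV §1 Prop. 3] [cite: CasselsFrohlichANT1967, Ch. VII §11] -/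
theorem localInvariantMap_localization_cupProduct_δ₀_eq_neg_apply_of_forall_ne
    (ψ : CyclicCharacter (absoluteGaloisGroup K) n) (hker : ψ.ker = galFixing K L) (b : Kˣ)
    (v : HeightOneSpectrum (𝓞 K))
    (hpos : ∀ (w : InfinitePlace K) (hw : w.IsReal),
      0 < InfinitePlace.Completion.extensionEmbeddingOfIsReal hw (algebraMap K w.Completion (b : K)))
    (hram : ∀ v' : HeightOneSpectrum (𝓞 K), v' ≠ v →
      (∃ σ ∈ absInertia (v'.adicCompletion K), ψ (absGaloisRestrict K (v'.adicCompletion K) σ) ≠ 0) →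
      haveI : CompactSpace (absoluteGaloisGroup K) := absoluteGaloisGroup_compactSpace K
      galoisCohomology.localization (mu K n) (Sum.inr v') 2 (((mu K n).tateDualPairing n).cupProduct
        ((isSES_kummer K n (NeZero.pos n)).δ₀ (baseUnitsInvariant K (b : K) b.ne_zero))
        (oneCocycleClass _ (scalarCocycle ψ))) = 0)
    (w : WeilGroup (v.adicCompletion K))
    (hw : canonicalArtin (v.adicCompletion K) w = globalToLocalUnits v b) :
    haveI : CompactSpace (absoluteGaloisGroup K) := absoluteGaloisGroup_compactSpace K
    localInvariantMap K n v (galoisCohomology.localization (mu K n) (Sum.inr v) 2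
        (((mu K n).tateDualPairing n).cupProduct
          ((isSES_kummer K n (NeZero.pos n)).δ₀ (baseUnitsInvariant K (b : K) b.ne_zero))
          (oneCocycleClass _ (scalarCocycle ψ)))) =
      -ψ (absGaloisRestrict K (v.adicCompletion K) (WeilGroup.toAbsGalois (v.adicCompletion K) w)) := by
  classical
  haveI : CompactSpace (absoluteGaloisGroup K) := absoluteGaloisGroup_compactSpace K
  -- `n = 1`: nothing to prove
  rcases Nat.lt_or_ge 1 n with hn1 | hn1
  swap
  · have hn : n = 1 := le_antisymm hn1 (NeZero.pos n)
    subst hn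
    exact Subsingleton.elim _ _
  set hR := artinReciprocity_character_holds
  set A := artinIdeleMap L hR with hA
  set c := ((mu K n).tateDualPairing n).cupProduct
    ((isSES_kummer K n (NeZero.pos n)).δ₀ (baseUnitsInvariant K (b : K) b.ne_zero))
    (oneCocycleClass _ (scalarCocycle ψ)) with hc
  obtain ⟨ψbar, hψbar_apply⟩ := exists_character_absRestrictNormalHom_eq L ψ hker
  -- the local terms `t_v' = ψ̄ (ψ_{L|K} ⟨b⟩_v')`, read additively
  set t : HeightOneSpectrum (𝓞 K) → ZMod n :=
    fun v' => Multiplicative.toAdd (ψbar (A (localUnits v' (globalToLocalUnits v' b)))) with ht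
  -- the term at `v` is `-ψ(res w)`
  have htv : t v = -ψ (absGaloisRestrict K (v.adicCompletion K) (WeilGroup.toAbsGalois (v.adicCompletion K) w)) := by
    rw [ht]
    change Multiplicative.toAdd (ψbar (A (localUnits v (globalToLocalUnits v b)))) = _
    rw [← hw, hA, artinIdeleMap_localUnits_canonicalArtin_eq_inv L w, map_inv, hψbar_apply, toAdd_inv,
      toAdd_ofAdd]
  -- Claim A: `t_v' = inv_v' (loc_v' c)` at every finite place `v' ≠ v`
  have hA_loc : ∀ v' : HeightOneSpectrum (𝓞 K), v' ≠ v →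
      t v' = localInvariantMap K n v' (galoisCohomology.localization (mu K n) (Sum.inr v') 2 c) := by
    intro v' hv'
    haveI : CharZero (v'.adicCompletion K) := charZero_adicCompletion v'
    by_cases hunr : ∀ σ ∈ absInertia (v'.adicCompletion K), ψ (absGaloisRestrict K (v'.adicCompletion K) σ) = 0
    · -- unramified: both sides are `-ψ(res w')` for `Art_v' w' = b`
      obtain ⟨ψE, hIE, hFE, -, -⟩ := exists_normalizedCharacter (v'.adicCompletion K) n hn1
      obtain ⟨f, hψf, hf⟩ := exists_apply_absGaloisRestrict_eq_mul (v'.adicCompletion K) ψ hunr ψE hIE hFE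
      have hinv := localInvariantMap_localization_cupProduct_δ₀ v' ψ ψE hIE hFE hψf (b : K) b.ne_zero
      rw [hc, hinv]
      obtain ⟨w', hw'⟩ := (isLocalArtinMap_canonicalArtin_holds (v'.adicCompletion K)).isOpenQuotientMap_artin.surjective
        (globalToLocalUnits v' b)
      have hord : ord (v'.adicCompletion K) (algebraMap K (v'.adicCompletion K) (b : K)) = -WeilGroup.deg w' := by
        rw [← val_globalToLocalUnits, ← hw', ord_canonicalArtin]
      rw [ht]
      change Multiplicative.toAdd (ψbar (A (localUnits v' (globalToLocalUnits v' b)))) = _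
      rw [← hw', hA, artinIdeleMap_localUnits_canonicalArtin_eq_inv L w', map_inv, hψbar_apply, toAdd_inv,
        toAdd_ofAdd, apply_absGaloisRestrict_toAbsGalois_eq v' ψ hunr hf w', hord, Int.cast_neg]
      ring
    · -- ramified `v' ≠ v`: the class vanishes at `v'`, `b` is a local norm, `ψ_{L|K}(⟨b⟩_v') = 1`
      push Not at hunr
      have h0 := hram v' hv' hunr
      have hres : resMu K (v'.adicCompletion K) n 2 c = 0 := by
        rw [← cohomologyMap_muLocalIso_localization, h0]; exact map_zero _
      have hnorm := mem_range_norm_compositum_of_resMu_cupProduct_δ₀_eq_zero v' L ψ hker b hres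
      have h1 : A (localUnits v' (globalToLocalUnits v' b)) = 1 :=
        (artinIdeleMap_localUnits_eq_one_iff_mem_range_norm L _).mpr hnorm
      rw [ht]
      change Multiplicative.toAdd (ψbar (A (localUnits v' (globalToLocalUnits v' b)))) = _
      rw [h1, map_one, toAdd_one, h0, map_zero]
  -- a norm modulus `S₀`, the support `T` of `b`, and `S' = {v} ∪ S₀ ∪ T`
  obtain ⟨S₀, hS₀⟩ := exists_map_unitIdelesOutside_le K (normClassGroup K L) (isOpen_normClassGroup' L)
  set T := (finite_setOf_valued_ne_one b).toFinset with hT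
  set S' := {v} ∪ S₀ ∪ T with hS'
  have hvS' : v ∈ S' := Finset.mem_union_left _ (Finset.mem_union_left _ (Finset.mem_singleton_self v))
  have hTS' : ∀ v' ∉ S', Valued.v (algebraMap K (v'.adicCompletion K) (b : K)) = 1 := by
    intro v' hv'
    by_contra h
    exact hv' (Finset.mem_union_right _ ((finite_setOf_valued_ne_one b).mem_toFinset.mpr h))
  -- Claim C: `t_v' = 0` off `S'`
  have hC : ∀ v' ∉ S', t v' = 0 := by
    intro v' hv'
    have hv'S₀ : v' ∉ S₀ := fun h => hv' (Finset.mem_union_left _ (Finset.mem_union_right _ h))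
    have h1 : A (localUnits v' (globalToLocalUnits v' b)) = 1 :=
      artinIdeleMap_localUnits_eq_one_of_not_mem L hS₀ hv'S₀ _ (by rw [val_globalToLocalUnits]; exact hTS' v' hv')
    rw [ht]
    change Multiplicative.toAdd (ψbar (A (localUnits v' (globalToLocalUnits v' b)))) = 0
    rw [h1, map_one, toAdd_one]
  -- Claim B: `∑_{v' ∈ S'} t_v' = 0` (Artin reciprocity for the principal idèle of `b`)
  obtain ⟨u, hu, hdec⟩ := principalIdele_mem_mul_unitIdelesOutside b S' hTS'
  have hAu : A u = 1 := by
    have hu' : u ∈ unitIdelesOutside K S₀ :=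
      unitIdelesOutside_antitone (Finset.subset_union_right.trans Finset.subset_union_left) hu
    have hmem : QuotientGroup.mk' (principalIdeles K) u ∈ normClassGroup K L :=
      hS₀ (Subgroup.mem_map_of_mem _ hu')
    rw [← ker_artinClassMap_eq L, MonoidHom.mem_ker, QuotientGroup.mk'_apply, artinClassMap_mk] at hmem
    exact hmem
  have hinf : A (infiniteIdeles K (globalToInfiniteUnits K b)) = 1 :=
    artinIdeleMap_infiniteIdeles_eq_one_of_pos L (globalToInfiniteUnits K b) fun w' hw' => hpos w' hw'
  set Φ : ideleGroup K →* Multiplicative (ZMod n) := ψbar.comp A with hΦ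
  have hprod : ∏ v' ∈ S', Φ (localUnits v' (globalToLocalUnits v' b)) = 1 := by
    have h : Φ (principalIdele K b) = 1 := by
      rw [hΦ, MonoidHom.comp_apply, hA, artinIdeleMap_eq_one_of_mem_principalIdeles L hR (principalIdele_mem b),
        map_one]
    rw [hdec, map_mul, map_mul, map_prod] at h
    have hΦu : Φ u = 1 := by rw [hΦ, MonoidHom.comp_apply, hAu, map_one]
    have hΦinf : Φ (infiniteIdeles K (globalToInfiniteUnits K b)) = 1 := by
      rw [hΦ, MonoidHom.comp_apply, hinf, map_one]
    rwa [hΦu, mul_one, hΦinf, mul_one] at h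
  have hsumB : ∑ v' ∈ S', t v' = 0 := by
    rw [ht]
    change ∑ v' ∈ S', Multiplicative.toAdd (Φ (localUnits v' (globalToLocalUnits v' b))) = 0
    rw [← toAdd_prod, hprod, toAdd_one]
  -- Claim D: `∑_{v' ∈ S'} inv_v' (loc_v' c) = 0` (reciprocity law of the Brauer group, all number fields)
  have hsumD : ∑ v' ∈ S', localInvariantMap K n v' (galoisCohomology.localization (mu K n) (Sum.inr v') 2 c) = 0 := by
    have hrecip := sumInvLocalizationEqZero_canonical_of_numberField K n c
      (S'.map ⟨Sum.inr, Sum.inr_injective⟩) fun p hp => ?_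
    · rwa [Finset.sum_map] at hrecip
    · rcases p with w' | v'
      · -- archimedean places: the class vanishes (`b >_w 0` at real `w`, everything at complex `w`)
        rw [LocalInvariants.canonical_inl]
        rcases w'.isReal_or_isComplex with hw' | hw'
        · rw [hc, localization_inl_cupProduct_δ₀_eq_zero_of_pos hw' (b : K) b.ne_zero (hpos w' hw'), map_zero]
        · rw [hc, localization_inl_cupProduct_δ₀_eq_zero_of_isComplex hw' (b : K) b.ne_zero, map_zero]
      · have hv' : v' ∉ S' := fun h => hp (Finset.mem_map.mpr ⟨v', h, rfl⟩)
        have hne : v' ≠ v := fun h => hv' (h ▸ hvS')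
        rw [LocalInvariants.canonical_inr, ← hA_loc v' hne, hC v' hv']
  -- assemble: the two sums agree off `v`
  rw [← Finset.add_sum_erase S' _ hvS'] at hsumB hsumD
  have hrest : ∑ v' ∈ S'.erase v, t v' =
      ∑ v' ∈ S'.erase v, localInvariantMap K n v' (galoisCohomology.localization (mu K n) (Sum.inr v') 2 c) :=
    Finset.sum_congr rfl fun v' hv' => hA_loc v' (Finset.ne_of_mem_erase hv')
  rw [hrest] at hsumB
  have key : localInvariantMap K n v (galoisCohomology.localization (mu K n) (Sum.inr v) 2 c) = t v := by
    have := hsumD.trans hsumB.symm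
    exact add_right_cancel this
  rw [key, htv]

end SideConditions


end Literature.NumberTheory.GaloisCohomology

end
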